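import Literature.MathematicalPhysics.QuantumLattice.HeatKernelGroupGeneratorProofs
import Literature.RepresentationTheory.CompactGroups.InvariantSubspaces
import HarnessLib

/-!
# Uniqueness of the heat kernel of a simple compact group up to time scale (brick 7, the theorem)

Discharge of the named fact
`Literature.MathematicalPhysics.QuantumLattice.isGroupHeatKernel_unique_up_to_scale`
(Hunt 1956, Thm 5.1 with Schur's lemma; Lévy 2010 §4.1–4.2; Liao 2004 Prop. 4.4–4.5):
`theorem isGroupHeatKernel_unique_up_to_scale_holds`. This file closes the chain

* `HeatKernelGroupConvolutionProofs`, `HeatKernelGroupOperatorProofs` (the heat semigroup on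
  `L²(G)`: compact symmetric commuting operators, spectral structure),
* `HeatKernelGroupPeterWeylProofs` (Peter–Weyl from the heat kernel: representative functions are
  dense and are finite sums of joint eigenfunctions),
* `HeatKernelGroupGeneratorProofs` (the Gaussian generating functional `gen`, and the rescaling
  theorem `eq_rescale_of_gen_eq`),
* `RepresentationTheory/CompactGroups/{TranslationFinite, PointDerivations, LeftInvariantDerivations,
  DerivationFlows, OneParameterSubgroups, NormalSubgroupsFromDerivations, InvariantSubspaces}`
  (Lie-free structure theory: on a non-abelian compact group without proper closed connected
  normal subgroups, `K/K²` has no proper conjugation-invariant subspaces),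

with the comparison of the two Gaussian forms `B_p(a,b) = gen_p(ab)`, `B_q`: their radicals are
`K²` (`genRadical_eq`: a degenerate form would make `G` finite, `exists_gen_mul_ne_zero`), and a
Rayleigh-quotient minimisation of `B_q` on `{B_p = 1}` in a finite-dimensional model of `K/K²`
produces `a₀ ∈ V_c ∖ K²` for the invariant proportionality locus `V_c` (`genProp`), which is
therefore all of `K` (`exists_gen_proportional`). No named facts are introduced; net effect: the
fact `isGroupHeatKernel_unique_up_to_scale` is discharged.
-/

open MeasureTheory Filter Topology
open Literature.MathematicalPhysics.QuantumFieldTheory (haarProbability)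

noncomputable section

namespace Literature.MathematicalPhysics.QuantumLattice

open Literature.RepresentationTheory.CompactGroups

variable {G : Type*} [Group G] [TopologicalSpace G] [IsTopologicalGroup G] [CompactSpace G]
  [MeasurableSpace G] [BorelSpace G]

/-! ### Auxiliary: an infinite compact Hausdorff space has infinite-dimensional `C(X, ℝ)` -/

omit [Group G] [IsTopologicalGroup G] [MeasurableSpace G] [BorelSpace G] in
/-- On an infinite compact Hausdorff space, `C(X, ℝ)` is not finite-dimensional: `n + 1` distinct
points carry Urysohn functions `uᵢ(xⱼ) = δᵢⱼ`, which are linearly independent. [folklore] -/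
theorem not_finiteDimensional_continuousMap [T2Space G] [Infinite G] : ¬ FiniteDimensional ℝ C(G, ℝ) := by
  classical
  intro hfd
  set n := Module.finrank ℝ C(G, ℝ)
  obtain ⟨s, hs⟩ := Infinite.exists_subset_card_eq G (n + 1)
  -- Urysohn functions
  have hu : ∀ x : s, ∃ u : C(G, ℝ), u x = 1 ∧ ∀ y : s, y ≠ x → u y = 0 := by
    intro x
    obtain ⟨u, hu0, hu1, -⟩ := exists_continuous_zero_one_of_isClosed
      (Set.Finite.isClosed (s := ((s.erase x : Finset G) : Set G)) (Finset.finite_toSet _))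
      (isClosed_singleton (x := (x : G)))
      (by
        rw [Set.disjoint_singleton_right]
        simp)
    refine ⟨u, hu1 (Set.mem_singleton _), fun y hy => ?_⟩
    have : (y : G) ∈ ((s.erase x : Finset G) : Set G) := by
      simp only [Finset.coe_erase, Set.mem_sdiff, Finset.mem_coe, Set.mem_singleton_iff]
      exact ⟨y.2, fun h => hy (Subtype.ext h)⟩
    exact hu0 this
  choose u hu1 hu0 using hu
  have hli : LinearIndependent ℝ u := by
    rw [linearIndependent_iff']
    intro t c hsum x hx
    have := congrArg (fun f : C(G, ℝ) => f x) hsum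
    simp only [ContinuousMap.coe_sum, Finset.sum_apply, ContinuousMap.coe_smul, Pi.smul_apply,
      smul_eq_mul, ContinuousMap.zero_apply] at this
    rw [Finset.sum_eq_single x (fun y _ hyx => by rw [hu0 y x (Ne.symm hyx), mul_zero])
      (fun hxt => absurd hx hxt), hu1, mul_one] at this
    exact this
  have hcard := hli.fintype_card_le_finrank
  simp only [Fintype.card_coe, hs] at hcard
  omega

namespace IsGroupHeatKernel

open scoped InnerProductSpace

variable {p : ℝ → G → ℝ}

section T2

variable [T2Space G]

/-! ### Non-degeneracy of the generating functional on a simple compact group -/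

/-- **The Gaussian form of a heat kernel is non-zero** on a compact Hausdorff group which is
connected and non-abelian: otherwise `gen = 0` on `R`, every eigenvalue of `T_1` is `1`, `E_1 = L²`
is finite-dimensional, hence so is `C(G, ℝ)`, contradicting that `G` (connected, Hausdorff,
non-trivial) is infinite. [folklore] -/
theorem exists_gen_mul_ne_zero (hp : IsGroupHeatKernel p) (hconn : ConnectedSpace G)
    (hab : ∃ a b : G, a * b ≠ b * a) :
    ∃ a ∈ augIdeal G, ∃ b ∈ augIdeal G, hp.gen (a * b) ≠ 0 := by
  by_contra H0
  push Not at H0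
  -- `gen = 0` on `R`
  have hR0 : ∀ u ∈ translationFinite G, hp.gen u = 0 := by
    intro u hu
    have := hp.gen_eq_mul_gen_of_aug hp (c₀ := 0) (fun a ha b hb => by rw [H0 a ha b hb, zero_mul]) u hu
    rwa [zero_mul] at this
  -- every eigenvalue of `T_1` is `1`
  have heig : ∀ (c : ℝ) (f : Lp ℝ 2 (haarProbability G)), f ∈ hp.eig c → f ≠ 0 → c = 1 := by
    intro c f hf hf0
    have hc : 0 < c := hp.eigenvalue_pos hf hf0
    obtain ⟨u, hu⟩ := hp.exists_toL2_eq_of_mem_eig hf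
    have hu0 : u ≠ 0 := fun h => hf0 (by rw [← hu, h, map_zero])
    obtain ⟨g, hg⟩ : ∃ g, u g ≠ 0 := by
      by_contra! h; exact hu0 (ContinuousMap.ext h)
    have huE : u ∈ hp.eigC c := by rw [mem_eigC_iff, hu]; exact hf
    have hu'E : lTrans g u ∈ hp.eigC c := hp.lTrans_mem_eigC huE g
    have hu'R : lTrans g u ∈ translationFinite G := hp.isTranslationFinite_of_mem_eigC hc.ne' hu'E
    have key := hp.gen_eq_of_mem_eigC hc hu'E
    rw [hR0 _ hu'R, lTrans_apply, mul_one] at key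
    have hlog : Real.log c = 0 := by
      have := mul_eq_zero.mp key.symm
      exact this.resolve_right hg
    rcases Real.log_eq_zero.mp hlog with h | h | h
    · linarith
    · exact h
    · linarith
  -- hence `E_1` is dense, closed, so everything; it is finite-dimensional
  have hle : (⨆ c, hp.eig c) ≤ hp.eig 1 := by
    refine iSup_le fun c f hf => ?_
    by_cases hf0 : f = 0
    · rw [hf0]; exact Submodule.zero_mem _
    · rw [← heig c f hf hf0]; exact hf
  have hclosed : IsClosed (hp.eig 1 : Set (Lp ℝ 2 (haarProbability G))) := Submodule.closed_of_finiteDimensional _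
  have htop : hp.eig 1 = ⊤ := by
    have h1 := Submodule.topologicalClosure_mono hle
    rw [hp.iSup_eig_dense, hclosed.submodule_topologicalClosure_eq] at h1
    exact top_le_iff.mp h1
  haveI : FiniteDimensional ℝ (Lp ℝ 2 (haarProbability G)) :=
    Module.Finite.equiv (LinearEquiv.ofTop _ htop)
  have hfdC : FiniteDimensional ℝ C(G, ℝ) :=
    Module.Finite.of_injective ((toL2 G : C(G, ℝ) →L[ℝ] Lp ℝ 2 (haarProbability G)) :
      C(G, ℝ) →ₗ[ℝ] Lp ℝ 2 (haarProbability G)) toL2_injective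
  -- but `G` is infinite
  obtain ⟨a, b, hab⟩ := hab
  haveI : Nontrivial G := ⟨⟨a, b, fun h => hab (by rw [h])⟩⟩
  haveI : Infinite G := PreconnectedSpace.infinite
  exact not_finiteDimensional_continuousMap hfdC

/-- The **radical** of the Gaussian form `B_p(a, b) = gen_p(ab)` on `K`:
`N_p = {a ∈ K | gen_p(a b) = 0 for all b ∈ K}`. [folklore] -/
def genRadical (hp : IsGroupHeatKernel p) : Submodule ℝ C(G, ℝ) where
  carrier := {a | a ∈ augIdeal G ∧ ∀ b ∈ augIdeal G, hp.gen (a * b) = 0}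
  add_mem' := fun {a a'} ha ha' => ⟨Submodule.add_mem _ ha.1 ha'.1, fun b hb => by
    rw [add_mul, hp.gen_add ((translationFinite G).mul_mem ha.1.1 hb.1)
      ((translationFinite G).mul_mem ha'.1.1 hb.1), ha.2 b hb, ha'.2 b hb, add_zero]⟩
  zero_mem' := ⟨Submodule.zero_mem _, fun b _ => by rw [zero_mul, hp.gen_zero]⟩
  smul_mem' := fun c a ha => ⟨Submodule.smul_mem _ c ha.1, fun b hb => by
    rw [smul_mul_assoc, hp.gen_smul c ((translationFinite G).mul_mem ha.1.1 hb.1), ha.2 b hb, mul_zero]⟩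

/-- Membership in the radical. [folklore] -/
theorem mem_genRadical_iff (hp : IsGroupHeatKernel p) {a : C(G, ℝ)} :
    a ∈ hp.genRadical ↔ a ∈ augIdeal G ∧ ∀ b ∈ augIdeal G, hp.gen (a * b) = 0 := Iff.rfl

/-- `gen_p(a b) = 0` for `a ∈ K`, `b ∈ K²` (Gaussian property). [folklore] -/
theorem gen_mul_eq_zero_of_mem_augIdealSq (hp : IsGroupHeatKernel p) {a b : C(G, ℝ)}
    (ha : a ∈ augIdeal G) (hb : b ∈ augIdealSq G) : hp.gen (a * b) = 0 := by
  suffices h : b ∈ augIdealSq G ∧ hp.gen (a * b) = 0 from h.2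
  refine Submodule.mul_induction_on hb (fun x hx y hy => ⟨Submodule.mul_mem_mul hx hy, ?_⟩)
    (fun x y hx hy => ⟨Submodule.add_mem _ hx.1 hy.1, ?_⟩)
  · exact hp.gen_mul_mul_eq_zero' ha hx hy
  · rw [mul_add, hp.gen_add ((translationFinite G).mul_mem ha.1 (augIdealSq_le hx.1).1)
      ((translationFinite G).mul_mem ha.1 (augIdealSq_le hy.1).1), hx.2, hy.2, add_zero]

/-- `K² ≤ N_p`. [folklore] -/
theorem augIdealSq_le_genRadical (hp : IsGroupHeatKernel p) : augIdealSq G ≤ hp.genRadical := by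
  intro a ha
  refine ⟨augIdealSq_le ha, fun b hb => ?_⟩
  rw [mul_comm]
  exact hp.gen_mul_eq_zero_of_mem_augIdealSq hb ha

/-- `N_p ≤ K`. [folklore] -/
theorem genRadical_le (hp : IsGroupHeatKernel p) : hp.genRadical ≤ augIdeal G := fun _ ha => ha.1

omit [T2Space G] in
/-- `gen_p` is invariant under the conjugation `κ_g`. [folklore] -/
theorem gen_conjTrans (hp : IsGroupHeatKernel p) (g : G) (u : C(G, ℝ)) : hp.gen (conjTrans g u) = hp.gen u :=
  hp.gen_conj u g

omit [CompactSpace G] [MeasurableSpace G] [BorelSpace G] [T2Space G] in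
/-- `κ_g a * b = κ_g (a * κ_{g⁻¹} b)`. [folklore] -/
theorem conjTrans_mul_eq (g : G) (a b : C(G, ℝ)) :
    conjTrans g a * b = conjTrans g (a * conjTrans g⁻¹ b) := by
  rw [map_mul, ← conjTrans_mul, inv_mul_cancel, conjTrans_one]

/-- `N_p` is conjugation invariant. [folklore] -/
theorem isConjInvariant_genRadical (hp : IsGroupHeatKernel p) : IsConjInvariant hp.genRadical := by
  intro g a ha
  refine ⟨conj_mem_augIdeal ha.1 g, fun b hb => ?_⟩
  rw [conjTrans_mul_eq, gen_conjTrans]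
  exact ha.2 _ (conj_mem_augIdeal hb g⁻¹)

/-- **Cauchy–Schwarz for the Gaussian form**: if `gen_p(a²) = 0` for `a ∈ K` then `gen_p(ab) = 0`
for all `b ∈ K` (positivity of `gen_p((a + t b)²)`). [folklore] -/
theorem gen_mul_eq_zero_of_gen_sq_eq_zero (hp : IsGroupHeatKernel p) {a : C(G, ℝ)}
    (ha : a ∈ augIdeal G) (h0 : hp.gen (a * a) = 0) {b : C(G, ℝ)} (hb : b ∈ augIdeal G) :
    hp.gen (a * b) = 0 := by
  -- elementary: `2 t b + t² c ≥ 0` for all `t` forces `b = 0`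
  have quad : ∀ {b c : ℝ}, (∀ t : ℝ, 0 ≤ 2 * t * b + t ^ 2 * c) → b = 0 := by
    intro b c h
    by_contra hb
    set s : ℝ := 1 / (|c| + 1) with hs
    have hs0 : 0 < s := by positivity
    have hsc : s * c ≤ 1 := by
      rw [hs, one_div, inv_mul_le_iff₀ (by positivity : (0 : ℝ) < |c| + 1)]
      linarith [le_abs_self c]
    have key := h (-(s * b))
    have : 2 * -(s * b) * b + (-(s * b)) ^ 2 * c = -(s * b ^ 2) * (2 - s * c) := by ring
    rw [this] at key
    have hb2 : 0 < b ^ 2 := by positivity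
    have : 0 < s * b ^ 2 * (2 - s * c) := by
      apply mul_pos (mul_pos hs0 hb2); linarith
    linarith
  refine quad (c := hp.gen (b * b)) fun t => ?_
  have hnn := hp.gen_sq_nonneg ((augIdeal G).add_mem ha ((augIdeal G).smul_mem t hb))
  have haR := ha.1
  have hbR := hb.1
  have hexp : (a + t • b) * (a + t • b) = a * a + (2 * t) • (a * b) + (t ^ 2) • (b * b) := by
    ext x
    simp only [ContinuousMap.mul_apply, ContinuousMap.add_apply, ContinuousMap.smul_apply, smul_eq_mul]
    ring
  rw [hexp, hp.gen_add ((translationFinite G).add_mem ((translationFinite G).mul_mem haR haR)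
      ((translationFinite G).smul_mem ((translationFinite G).mul_mem haR hbR) _))
      ((translationFinite G).smul_mem ((translationFinite G).mul_mem hbR hbR) _),
    hp.gen_add ((translationFinite G).mul_mem haR haR)
      ((translationFinite G).smul_mem ((translationFinite G).mul_mem haR hbR) _),
    hp.gen_smul _ ((translationFinite G).mul_mem haR hbR), hp.gen_smul _ ((translationFinite G).mul_mem hbR hbR),
    h0, zero_add] at hnn
  linarith

/-- **The Gaussian form is non-degenerate on `K/K²`**: on a simple compact group, `N_p = K²`. [folklore] -/
theorem genRadical_eq (hp : IsGroupHeatKernel p) (hG : IsSimpleCompactGroup G) :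
    hp.genRadical = augIdealSq G := by
  rcases (hp.isConjInvariant_genRadical).eq_augIdealSq_or_eq_augIdeal hG.2.2 hG.2.1
    hp.separatesPoints_translationFinite hp.augIdealSq_le_genRadical hp.genRadical_le with h | h
  · exact h
  · exfalso
    obtain ⟨a, ha, b, hb, hne⟩ := hp.exists_gen_mul_ne_zero hG.1 hG.2.1
    have : a ∈ hp.genRadical := by rw [h]; exact ha
    exact hne (this.2 b hb)

/-! ### The proportionality locus `V_λ` -/

/-- The locus `V_λ = {a ∈ K | gen_q(a y) = λ gen_p(a y) for all y ∈ K}` of two heat kernels: a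
conjugation-invariant subspace between `K²` and `K`. [folklore] -/
def genProp (hp : IsGroupHeatKernel p) {q : ℝ → G → ℝ} (hq : IsGroupHeatKernel q) (l : ℝ) :
    Submodule ℝ C(G, ℝ) where
  carrier := {a | a ∈ augIdeal G ∧ ∀ y ∈ augIdeal G, hq.gen (a * y) = l * hp.gen (a * y)}
  add_mem' := fun {a a'} ha ha' => ⟨Submodule.add_mem _ ha.1 ha'.1, fun y hy => by
    rw [add_mul, hq.gen_add ((translationFinite G).mul_mem ha.1.1 hy.1)
      ((translationFinite G).mul_mem ha'.1.1 hy.1), hp.gen_add ((translationFinite G).mul_mem ha.1.1 hy.1)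
      ((translationFinite G).mul_mem ha'.1.1 hy.1), ha.2 y hy, ha'.2 y hy]
    ring⟩
  zero_mem' := ⟨Submodule.zero_mem _, fun y _ => by rw [zero_mul, hq.gen_zero, hp.gen_zero, mul_zero]⟩
  smul_mem' := fun c a ha => ⟨Submodule.smul_mem _ c ha.1, fun y hy => by
    rw [smul_mul_assoc, hq.gen_smul c ((translationFinite G).mul_mem ha.1.1 hy.1),
      hp.gen_smul c ((translationFinite G).mul_mem ha.1.1 hy.1), ha.2 y hy]
    ring⟩

/-- `K² ≤ V_λ`. [folklore] -/
theorem augIdealSq_le_genProp (hp : IsGroupHeatKernel p) {q : ℝ → G → ℝ} (hq : IsGroupHeatKernel q) (l : ℝ) :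
    augIdealSq G ≤ hp.genProp hq l := by
  intro a ha
  refine ⟨augIdealSq_le ha, fun y hy => ?_⟩
  rw [mul_comm, hq.gen_mul_eq_zero_of_mem_augIdealSq hy ha, hp.gen_mul_eq_zero_of_mem_augIdealSq hy ha, mul_zero]

/-- `V_λ ≤ K`. [folklore] -/
theorem genProp_le (hp : IsGroupHeatKernel p) {q : ℝ → G → ℝ} (hq : IsGroupHeatKernel q) (l : ℝ) :
    hp.genProp hq l ≤ augIdeal G := fun _ ha => ha.1

/-- `V_λ` is conjugation invariant. [folklore] -/
theorem isConjInvariant_genProp (hp : IsGroupHeatKernel p) {q : ℝ → G → ℝ} (hq : IsGroupHeatKernel q)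
    (l : ℝ) : IsConjInvariant (hp.genProp hq l) := by
  intro g a ha
  refine ⟨conj_mem_augIdeal ha.1 g, fun y hy => ?_⟩
  rw [conjTrans_mul_eq, gen_conjTrans, gen_conjTrans]
  exact ha.2 _ (conj_mem_augIdeal hy g⁻¹)

/-! ### Proportionality of the two Gaussian forms (Rayleigh quotient + structure theorem) -/

/-- **On a simple compact group two heat kernels have proportional Gaussian forms**: there is
`c > 0` with `gen_q(a b) = c · gen_p(a b)` for all `a, b ∈ K`. Proof: by the structure theorem the
radicals of both forms are `K²`, and `K = F' + K²` with `F'` finite-dimensional; on a linear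
complement `F₁ ≅ ℝᵐ` of `F' ∩ K²` the form `gen_p(x²)` is positive definite, so the level set
`{gen_p(x²) = 1}` is compact and `gen_q(x²)` attains its minimum `c` there at some `x₀`; the
first-order condition gives `gen_q(x₀ y) = c gen_p(x₀ y)` for all `y ∈ K`, i.e. `x₀ ∈ V_c ∖ K²`, so
the conjugation-invariant `V_c` is all of `K` by the structure theorem; `c > 0` since the form of `q`
is non-zero. This is the Lie-free form of "an `Ad`-invariant inner product on a simple Lie algebra is
unique up to scale" (Schur). [folklore] -/
theorem exists_gen_proportional (hp : IsGroupHeatKernel p) {q : ℝ → G → ℝ} (hq : IsGroupHeatKernel q)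
    (hG : IsSimpleCompactGroup G) :
    ∃ c : ℝ, 0 < c ∧ ∀ a ∈ augIdeal G, ∀ b ∈ augIdeal G, hq.gen (a * b) = c * hp.gen (a * b) := by
  classical
  -- elementary: `2 t b + t² c ≥ 0` for all `t` forces `b = 0`
  have quad : ∀ {b c : ℝ}, (∀ t : ℝ, 0 ≤ 2 * t * b + t ^ 2 * c) → b = 0 := by
    intro b c h
    by_contra hb
    set s : ℝ := 1 / (|c| + 1) with hs
    have hs0 : 0 < s := by positivity
    have hsc : s * c ≤ 1 := by
      rw [hs, one_div, inv_mul_le_iff₀ (by positivity : (0 : ℝ) < |c| + 1)]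
      linarith [le_abs_self c]
    have key := h (-(s * b))
    have : 2 * -(s * b) * b + (-(s * b)) ^ 2 * c = -(s * b ^ 2) * (2 - s * c) := by ring
    rw [this] at key
    have hb2 : 0 < b ^ 2 := by positivity
    have : 0 < s * b ^ 2 * (2 - s * c) := by
      apply mul_pos (mul_pos hs0 hb2); linarith
    linarith
  have hR := hp.separatesPoints_translationFinite
  obtain ⟨F', hfd, hF'K, -, hF'sup⟩ := exists_finiteDimensional_sup_augIdealSq_eq hG.2.2 hR
  haveI := hfd
  set F₀ : Submodule ℝ F' := (augIdealSq G).comap F'.subtype with hF₀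
  obtain ⟨F₁, hc⟩ := F₀.exists_isCompl
  haveI : FiniteDimensional ℝ F₁ := FiniteDimensional.finiteDimensional_submodule F₁
  obtain ⟨a₁, ha₁, b₁, hb₁, hne₁⟩ := hp.exists_gen_mul_ne_zero hG.1 hG.2.1
  -- `F₁ ≠ ⊥`
  have hF₁ : F₁ ≠ ⊥ := by
    intro h
    have haK2 : a₁ ∈ augIdealSq G := by
      have : a₁ ∈ F' ⊔ augIdealSq G := by rw [hF'sup]; exact ha₁
      obtain ⟨f, hf, k, hk, rfl⟩ := Submodule.mem_sup.mp this
      have hfF₀ : (⟨f, hf⟩ : F') ∈ F₀ := by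
        have : (⟨f, hf⟩ : F') ∈ F₀ ⊔ F₁ := by rw [hc.sup_eq_top]; exact Submodule.mem_top
        rw [h, sup_bot_eq] at this; exact this
      exact Submodule.add_mem _ hfF₀ hk
    exact hne₁ ((hp.augIdealSq_le_genRadical haK2).2 b₁ hb₁)
  haveI : Nontrivial F₁ := Submodule.nontrivial_iff_ne_bot.mpr hF₁
  set m := Module.finrank ℝ F₁ with hm_def
  have hm : 0 < m := Module.finrank_pos (R := ℝ) (M := F₁)
  haveI : Module.Free ℝ F₁ := Module.Free.of_divisionRing ℝ F₁
  -- coordinates `ℝᵐ ≅ F₁` and the parametrisation `vec : ℝᵐ → C(G, ℝ)`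
  set e : F₁ ≃ₗ[ℝ] (Fin m → ℝ) := (Module.finBasis ℝ F₁).equivFun with he
  set vec : (Fin m → ℝ) →ₗ[ℝ] C(G, ℝ) := F'.subtype ∘ₗ F₁.subtype ∘ₗ e.symm.toLinearMap with hvec
  have hvec_apply : ∀ c, vec c = (((e.symm c : F₁) : F') : C(G, ℝ)) := fun c => rfl
  have hvecK : ∀ c, vec c ∈ augIdeal G := fun c => hF'K ((e.symm c : F₁) : F').2
  have hvecR : ∀ c, vec c ∈ translationFinite G := fun c => (hvecK c).1
  have hvec_inj : ∀ c, vec c = 0 → c = 0 := by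
    intro c h0
    have h1 : ((e.symm c : F₁) : F') = 0 := Subtype.ext (by rw [← hvec_apply]; exact h0)
    have h2 : (e.symm c : F₁) = 0 := Subtype.ext h1
    simpa using congrArg e h2
  -- the two bilinear forms in coordinates
  set Bp : (Fin m → ℝ) →ₗ[ℝ] (Fin m → ℝ) →ₗ[ℝ] ℝ := LinearMap.mk₂ ℝ (fun c d => hp.genExt (vec c * vec d))
    (fun c c' d => by rw [map_add, add_mul, map_add]) (fun r c d => by rw [map_smul, smul_mul_assoc, map_smul])
    (fun c d d' => by rw [map_add, mul_add, map_add]) (fun r c d => by rw [map_smul, mul_smul_comm, map_smul])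
    with hBp_def
  set Bq : (Fin m → ℝ) →ₗ[ℝ] (Fin m → ℝ) →ₗ[ℝ] ℝ := LinearMap.mk₂ ℝ (fun c d => hq.genExt (vec c * vec d))
    (fun c c' d => by rw [map_add, add_mul, map_add]) (fun r c d => by rw [map_smul, smul_mul_assoc, map_smul])
    (fun c d d' => by rw [map_add, mul_add, map_add]) (fun r c d => by rw [map_smul, mul_smul_comm, map_smul])
    with hBq_def
  have hBp : ∀ c d, Bp c d = hp.gen (vec c * vec d) := fun c d =>
    hp.genExt_apply ((translationFinite G).mul_mem (hvecR c) (hvecR d))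
  have hBq : ∀ c d, Bq c d = hq.gen (vec c * vec d) := fun c d =>
    hq.genExt_apply ((translationFinite G).mul_mem (hvecR c) (hvecR d))
  have hBp_comm : ∀ c d, Bp c d = Bp d c := fun c d => by rw [hBp, hBp, mul_comm]
  have hBq_comm : ∀ c d, Bq c d = Bq d c := fun c d => by rw [hBq, hBq, mul_comm]
  -- expansions of the quadratic forms
  have hexp : ∀ (B : (Fin m → ℝ) →ₗ[ℝ] (Fin m → ℝ) →ₗ[ℝ] ℝ), (∀ c d, B c d = B d c) → ∀ (c d : Fin m → ℝ) (t : ℝ),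
      B (c + t • d) (c + t • d) = B c c + 2 * t * B c d + t ^ 2 * B d d := by
    intro B hB c d t
    simp only [map_add, map_smul, LinearMap.add_apply, LinearMap.smul_apply, smul_eq_mul, hB d c]
    ring
  have hsq : ∀ (B : (Fin m → ℝ) →ₗ[ℝ] (Fin m → ℝ) →ₗ[ℝ] ℝ) (s : ℝ) (c : Fin m → ℝ),
      B (s • c) (s • c) = s ^ 2 * B c c := by
    intro B s c
    simp only [map_smul, LinearMap.smul_apply, smul_eq_mul]; ring
  -- continuity of the quadratic forms
  have hcont : ∀ (B : (Fin m → ℝ) →ₗ[ℝ] (Fin m → ℝ) →ₗ[ℝ] ℝ), Continuous fun c => B c c := by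
    intro B
    set BC : (Fin m → ℝ) →L[ℝ] (Fin m → ℝ) →L[ℝ] ℝ := LinearMap.toContinuousLinearMap
      ((LinearMap.toContinuousLinearMap : ((Fin m → ℝ) →ₗ[ℝ] ℝ) ≃ₗ[ℝ] ((Fin m → ℝ) →L[ℝ] ℝ)).toLinearMap ∘ₗ B)
    have h := BC.continuous₂.comp (continuous_id.prodMk continuous_id)
    exact h
  -- positivity of `Bp` on `ℝᵐ`
  have hBp_nonneg : ∀ c, 0 ≤ Bp c c := fun c => by rw [hBp]; exact hp.gen_sq_nonneg (hvecK c)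
  have hBq_nonneg : ∀ c, 0 ≤ Bq c c := fun c => by rw [hBq]; exact hq.gen_sq_nonneg (hvecK c)
  have hBp_pos : ∀ c, c ≠ 0 → 0 < Bp c c := by
    intro c hc0
    refine lt_of_le_of_ne (hBp_nonneg c) fun h0 => hc0 ?_
    -- `vec c` is in the radical `K²`, hence in `F₀ ∩ F₁ = 0`
    have hrad : vec c ∈ hp.genRadical := ⟨hvecK c, fun b hb =>
      hp.gen_mul_eq_zero_of_gen_sq_eq_zero (hvecK c) (by rw [← hBp]; exact h0.symm) hb⟩
    rw [hp.genRadical_eq hG] at hrad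
    have h1 : ((e.symm c : F₁) : F') ∈ F₀ := hrad
    have h2 : ((e.symm c : F₁) : F') ∈ F₁ := (e.symm c).2
    have h3 : ((e.symm c : F₁) : F') = 0 := by
      have := Submodule.disjoint_def.mp hc.disjoint _ h1 h2
      exact this
    exact hvec_inj c (by rw [hvec_apply, h3]; rfl)
  -- lower bound `Bp c c ≥ m₀ ‖c‖²` from the unit sphere
  set i₀ : Fin m := ⟨0, hm⟩
  have hsphere : IsCompact (Metric.sphere (0 : Fin m → ℝ) 1) := isCompact_sphere _ _
  have hsphere_ne : (Metric.sphere (0 : Fin m → ℝ) 1).Nonempty :=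
    ⟨Pi.single i₀ 1, by simp [Pi.norm_single]⟩
  obtain ⟨c₁, hc₁, hmin₁⟩ := hsphere.exists_isMinOn hsphere_ne (hcont Bp).continuousOn
  set m₀ := Bp c₁ c₁ with hm₀
  have hc₁0 : c₁ ≠ 0 := by
    intro h; rw [h] at hc₁; simp at hc₁
  have hm₀pos : 0 < m₀ := hBp_pos c₁ hc₁0
  have hlower : ∀ c, m₀ * ‖c‖ ^ 2 ≤ Bp c c := by
    intro c
    by_cases hc0 : c = 0
    · rw [hc0, norm_zero]; simp
    · have hn : 0 < ‖c‖ := norm_pos_iff.mpr hc0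
      have hunit : ‖c‖⁻¹ • c ∈ Metric.sphere (0 : Fin m → ℝ) 1 := by
        rw [mem_sphere_zero_iff_norm, norm_smul, norm_inv, norm_norm, inv_mul_cancel₀ hn.ne']
      have h1 : Bp c₁ c₁ ≤ Bp (‖c‖⁻¹ • c) (‖c‖⁻¹ • c) := hmin₁ hunit
      rw [hsq] at h1
      have h2 : m₀ * ‖c‖ ^ 2 ≤ ‖c‖⁻¹ ^ 2 * Bp c c * ‖c‖ ^ 2 := by gcongr
      calc m₀ * ‖c‖ ^ 2 ≤ ‖c‖⁻¹ ^ 2 * Bp c c * ‖c‖ ^ 2 := h2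
        _ = Bp c c := by field_simp
  -- the compact level set `S = {Bp = 1}` and the minimum of `Bq` on it
  set S : Set (Fin m → ℝ) := {c | Bp c c = 1} with hS
  have hS_closed : IsClosed S := isClosed_eq (hcont Bp) continuous_const
  have hS_bdd : Bornology.IsBounded S := by
    refine (Metric.isBounded_closedBall (x := (0 : Fin m → ℝ)) (r := Real.sqrt (1 / m₀))).subset fun c hc => ?_
    rw [Metric.mem_closedBall, dist_zero_right]
    have h1 : m₀ * ‖c‖ ^ 2 ≤ 1 := by rw [← show Bp c c = 1 from hc]; exact hlower c
    have h2 : ‖c‖ ^ 2 ≤ 1 / m₀ := by rw [le_div_iff₀ hm₀pos]; linarith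
    calc ‖c‖ = Real.sqrt (‖c‖ ^ 2) := by rw [Real.sqrt_sq (norm_nonneg _)]
      _ ≤ Real.sqrt (1 / m₀) := Real.sqrt_le_sqrt h2
  have hS_cpt : IsCompact S := Metric.isCompact_of_isClosed_isBounded hS_closed hS_bdd
  have hS_ne : S.Nonempty := by
    set s₀ := Bp c₁ c₁
    refine ⟨(Real.sqrt s₀)⁻¹ • c₁, ?_⟩
    show Bp _ _ = 1
    rw [hsq, inv_pow, Real.sq_sqrt hm₀pos.le, inv_mul_cancel₀ hm₀pos.ne']
  obtain ⟨cs, hcs, hmin⟩ := hS_cpt.exists_isMinOn hS_ne (hcont Bq).continuousOn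
  have hcs1 : Bp cs cs = 1 := hcs
  set l := Bq cs cs with hl
  -- `Bq w w ≥ l * Bp w w` for all `w`
  have hineq : ∀ w, l * Bp w w ≤ Bq w w := by
    intro w
    by_cases hw : Bp w w = 0
    · have hw0 : w = 0 := by by_contra h; exact (hBp_pos w h).ne' hw
      rw [hw0]; simp
    · have hs : 0 < Bp w w := lt_of_le_of_ne (hBp_nonneg w) (Ne.symm hw)
      set r := (Real.sqrt (Bp w w))⁻¹
      have hr2 : r ^ 2 * Bp w w = 1 := by
        rw [inv_pow, Real.sq_sqrt hs.le, inv_mul_cancel₀ hs.ne']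
      have hmem : r • w ∈ S := by show Bp _ _ = 1; rw [hsq, hr2]
      have h1 : Bq cs cs ≤ Bq (r • w) (r • w) := hmin hmem
      rw [hsq] at h1
      -- `l ≤ r² Bq w w` and `r² = 1 / Bp w w`
      have h2 : l * Bp w w ≤ r ^ 2 * Bq w w * Bp w w := by gcongr
      calc l * Bp w w ≤ r ^ 2 * Bq w w * Bp w w := h2
        _ = Bq w w * (r ^ 2 * Bp w w) := by ring
        _ = Bq w w := by rw [hr2, mul_one]
  -- first-order condition: `Bq cs d = l * Bp cs d`
  have hfirst : ∀ d, Bq cs d = l * Bp cs d := by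
    intro d
    have h := quad (b := Bq cs d - l * Bp cs d) (c := Bq d d - l * Bp d d) fun t => by
      have h1 := hineq (cs + t • d)
      rw [hexp Bq hBq_comm, hexp Bp hBp_comm, hcs1] at h1
      have : 2 * t * (Bq cs d - l * Bp cs d) + t ^ 2 * (Bq d d - l * Bp d d) =
          (Bq cs cs + 2 * t * Bq cs d + t ^ 2 * Bq d d) - l * (1 + 2 * t * Bp cs d + t ^ 2 * Bp d d) := by
        rw [hl]; ring
      rw [this]; linarith
    linarith
  -- translate: `a₀ = vec cs ∈ V_l`, `a₀ ∉ K²`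
  set a₀ := vec cs with ha₀
  have ha₀K : a₀ ∈ augIdeal G := hvecK cs
  have ha₀prop : a₀ ∈ hp.genProp hq l := by
    refine ⟨ha₀K, fun y hy => ?_⟩
    have hy' : y ∈ F' ⊔ augIdealSq G := by rw [hF'sup]; exact hy
    obtain ⟨f, hf, k, hk, rfl⟩ := Submodule.mem_sup.mp hy'
    have hfdec : (⟨f, hf⟩ : F') ∈ F₀ ⊔ F₁ := by rw [hc.sup_eq_top]; exact Submodule.mem_top
    obtain ⟨f₀, hf₀, f₁, hf₁, hf01⟩ := Submodule.mem_sup.mp hfdec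
    set d := e ⟨f₁, hf₁⟩ with hd
    have hvd : vec d = (f₁ : C(G, ℝ)) := by rw [hvec_apply, hd, LinearEquiv.symm_apply_apply]
    have hf_eq : f = vec d + (f₀ : C(G, ℝ)) := by
      have := congrArg Subtype.val hf01
      simp only [Submodule.coe_add] at this
      rw [hvd, ← this]; abel
    have hk2 : (f₀ : C(G, ℝ)) + k ∈ augIdealSq G := Submodule.add_mem _ hf₀ hk
    have hsplit : a₀ * (f + k) = a₀ * vec d + a₀ * ((f₀ : C(G, ℝ)) + k) := by rw [hf_eq]; ring
    have hR1 : a₀ * vec d ∈ translationFinite G := (translationFinite G).mul_mem ha₀K.1 (hvecR d)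
    have hR2 : a₀ * ((f₀ : C(G, ℝ)) + k) ∈ translationFinite G :=
      (translationFinite G).mul_mem ha₀K.1 (augIdealSq_le hk2).1
    rw [hsplit, hq.gen_add hR1 hR2, hp.gen_add hR1 hR2, hq.gen_mul_eq_zero_of_mem_augIdealSq ha₀K hk2,
      hp.gen_mul_eq_zero_of_mem_augIdealSq ha₀K hk2, add_zero, add_zero, ← hBq, ← hBp]
    exact hfirst d
  have ha₀notin : a₀ ∉ augIdealSq G := by
    intro h
    have := hp.gen_mul_eq_zero_of_mem_augIdealSq ha₀K h
    rw [← hBp, hcs1] at this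
    exact one_ne_zero this
  -- the structure theorem: `V_l = K`
  have hVK : hp.genProp hq l = augIdeal G := by
    rcases (hp.isConjInvariant_genProp hq l).eq_augIdealSq_or_eq_augIdeal hG.2.2 hG.2.1 hR
      (hp.augIdealSq_le_genProp hq l) (hp.genProp_le hq l) with h | h
    · exfalso; rw [h] at ha₀prop; exact ha₀notin ha₀prop
    · exact h
  have H : ∀ a ∈ augIdeal G, ∀ b ∈ augIdeal G, hq.gen (a * b) = l * hp.gen (a * b) := by
    intro a ha b hb
    have : a ∈ hp.genProp hq l := by rw [hVK]; exact ha
    exact this.2 b hb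
  -- `l > 0`
  have hl0 : 0 ≤ l := hBq_nonneg cs
  have hlpos : 0 < l := by
    refine lt_of_le_of_ne hl0 fun h0 => ?_
    obtain ⟨a, ha, b, hb, hne⟩ := hq.exists_gen_mul_ne_zero hG.1 hG.2.1
    apply hne
    rw [H a ha b hb, ← h0, zero_mul]
  exact ⟨l, hlpos, H⟩

end T2

end IsGroupHeatKernel

/-! ### The theorem -/

/-- **Discharge of `isGroupHeatKernel_unique_up_to_scale` (Hunt 1956, Thm 5.1 with Schur's lemma;
Lévy, Astérisque 329 (2010), §4.1–4.2; Liao 2004, Prop. 4.4–4.5).** On a simple compact connected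
(Hausdorff) group any two heat kernels differ by a rescaling of time: `q_t = p_{ct}`, `c > 0`.
Proof (entirely from Mathlib, no Lie theory): the heat semigroup on `L²(G)` is a commuting family of
compact symmetric operators (`HeatKernelGroupOperatorProofs`), whence a Peter–Weyl theory for `G`
and the algebra `R` of representative functions (`HeatKernelGroupPeterWeylProofs`); the generating
functional `ψ_p = lim 2ⁿ(∫ u p_{2⁻ⁿ} - u(1))` is a symmetric, `Ad`-invariant, positive Gaussian
form on `K/K²` which determines the kernel up to the identity `q_t = p_{ct} ⇐ ψ_q = c ψ_p`
(`HeatKernelGroupGeneratorProofs`); the Lie-free structure theory of `G` through point derivations of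
`R`, their flows and one-parameter subgroups (`RepresentationTheory/CompactGroups/…`) shows that on a
simple compact group `K/K²` has no proper invariant subspaces, so two such forms are proportional
(`IsGroupHeatKernel.exists_gen_proportional`). [cite: Hunt1956, Thm 5.1 with Schur's lemma] -/
theorem isGroupHeatKernel_unique_up_to_scale_holds : isGroupHeatKernel_unique_up_to_scale (G := G) := by
  intro _ hG p q hp hq
  obtain ⟨c, hc, H⟩ := hp.exists_gen_proportional hq hG
  exact ⟨c, hc, hp.eq_rescale_of_gen_eq hq hc H⟩

end Literature.MathematicalPhysics.QuantumLattice
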